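import Mathlib
import Literature.Computability.Complexity.KWProtocol
import Literature.Computability.Complexity.KWProtocolBounds

/-!
# Crux `ShallowShadows.ShadowFormulaTransfer` (stmt-ValiantsHypothesis-17124), line
# `Sketch-ideator1` — the registered stub `stub_kwOrAnd`

The folklore **combination protocol** for the MONOTONE Karchmer–Wigderson game of an
`∨`-of-`∧` of Boolean functions: if every `h i j` (`i < T`, `j < k`) has a protocol tree of depth
`≤ D` solving its monotone game, then `g = ∨_{i<T} ∧_{j<k} h i j` has one of depth
`≤ ⌈log₂ T⌉ + ⌈log₂ k⌉ + D`. Alice, holding `a` with `g a = 1`, announces an index `i` with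
`∀ j, h i j a = 1` (`⌈log₂ T⌉` bits); Bob, holding `b` with `g b = 0`, so in particular
`∧_j h i j b = 0`, announces a `j` with `h i j b = 0` (`⌈log₂ k⌉` bits); the pair `(a, b)` is then
a legal input pair of the monotone game of `h i j`, and the players continue with its protocol.
This is the protocol behind the upper bound `C(R^m_{f ∨ g}) ≤ 1 + max` / `C(R^m_{f ∧ g}) ≤ 1 + max`
of Karchmer–Wigderson iterated over a balanced `∨`/`∧` tree of fan-in `T` resp. `k`.

In line `Sketch-ideator1` a sum-of-squares certificate expresses the shadow of a `0/1` VP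
polynomial as `∨_{i<T} ∧_{j<k} h i j` with each `h i j` the shadow of a low-degree factor; this
stub combines the factor protocols.

Main results: `exists_kwTree_or_and` (abstract form, any `decide`-spelling `g` of the
disjunction of conjunctions) and the registered signature `stub_kwOrAnd`.

References: M. Karchmer, A. Wigderson, *Monotone circuits for connectivity require
super-logarithmic depth*, SIAM J. Discrete Math. 3 (1990), §2 (the monotone game `R_f^m`, the
protocols for `f ∨ g`, `f ∧ g`); S. Jukna, *Boolean Function Complexity* (2012), §3.3 (a player
names one of `t` alternatives with `⌈log₂ t⌉` bits). The "send a number" combinators are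
`Literature.Computability.Complexity.KWTree.aliceChoose` / `bobChoose` (`KWProtocol.lean`); the
two-phase template is `KWTree.exists_solvesMono_of_choice` (`KWProtocolBounds.lean`).
-/

-- Sub = Summit single-conjunct layout: the duplicated namespace component is mandated by the tree.
set_option linter.dupNamespace false

namespace Summit.ValiantsHypothesis.ValiantsHypothesis.Theorems.ShallowShadowsShadowFormulaTransfer

open Literature.Computability.Complexity

/-- **Combination protocol for an `∨`-of-`∧` (abstract form).** If the protocol tree `P i j`
solves the monotone Karchmer–Wigderson game of `h i j` in depth `≤ D` for all `i : Fin T`,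
`j : Fin k`, and `g` is (any spelling of) the Boolean function `a ↦ ∨_{i} ∧_{j} h i j a`, then the
monotone game of `g` has a protocol tree of depth `≤ ⌈log₂ T⌉ + ⌈log₂ k⌉ + D`: Alice names an `i`
with `∀ j, h i j a = 1`, Bob names a `j` with `h i j b = 0`, and they continue with `P i j` on the
pair `(a, b)`, which is a legal pair of its game.
[cite: KarchmerWigderson1990, §2 (protocols for f ∨ g and f ∧ g in the monotone game)]
[cite: JuknaBFC2012, §3.3] -/
theorem exists_kwTree_or_and {ι : Type*} [Nonempty ι] {T k D : ℕ}
    (h : Fin T → Fin k → (ι → Bool) → Bool) (P : Fin T → Fin k → KWTree ι)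
    (hP : ∀ i j, (P i j).SolvesMono (h i j)) (hD : ∀ i j, (P i j).depth ≤ D)
    (g : (ι → Bool) → Bool) (hg : ∀ a, g a = true ↔ ∃ i, ∀ j, h i j a = true) :
    ∃ Q : KWTree ι, Q.SolvesMono g ∧ Q.depth ≤ Nat.clog 2 T + Nat.clog 2 k + D := by
  classical
  -- the subprotocols, extended to all of `ℕ × ℕ` by a dummy leaf
  let P' : ℕ → ℕ → KWTree ι := fun i j =>
    if hij : i < T ∧ j < k then P ⟨i, hij.1⟩ ⟨j, hij.2⟩ else KWTree.leaf (Classical.arbitrary ι)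
  -- Alice's number: an index `i` all of whose `h i j` are true at `a`
  let cA : (ι → Bool) → ℕ := fun a =>
    if ha : ∃ i : Fin T, ∀ j, h i j a = true then ((Classical.choose ha : Fin T) : ℕ) else 0
  -- Bob's number, given Alice's index `i`: a `j` with `h i j b` false
  let cB : ℕ → (ι → Bool) → ℕ := fun i b =>
    if hb : ∃ j : Fin k, ∃ i' : Fin T, (i' : ℕ) = i ∧ h i' j b = false then
      ((Classical.choose hb : Fin k) : ℕ) else 0
  refine ⟨KWTree.aliceChoose (Nat.clog 2 T) cA fun i =>
      KWTree.bobChoose (Nat.clog 2 k) (cB i) fun j => P' i j, ?_, ?_⟩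
  · intro a b ha hb
    -- Alice's index `i₀ := Classical.choose ha'`
    have ha' : ∃ i : Fin T, ∀ j, h i j a = true := (hg a).mp ha
    have hi₀ : ∀ j, h (Classical.choose ha') j a = true := Classical.choose_spec ha'
    have hcA : cA a = ((Classical.choose ha' : Fin T) : ℕ) := by simp only [cA, dif_pos ha']
    -- Bob's index `j₀ := Classical.choose hb'`
    have hb' : ∃ j : Fin k, ∃ i' : Fin T,
        (i' : ℕ) = ((Classical.choose ha' : Fin T) : ℕ) ∧ h i' j b = false := by
      by_contra hcon
      push Not at hcon
      have hgb : g b = true :=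
        (hg b).mpr ⟨Classical.choose ha', fun j => by simpa using hcon j (Classical.choose ha') rfl⟩
      rw [hb] at hgb
      exact Bool.false_ne_true hgb
    have hj₀ : h (Classical.choose ha') (Classical.choose hb') b = false := by
      obtain ⟨i', hi', hj⟩ := Classical.choose_spec hb'
      obtain rfl : i' = Classical.choose ha' := Fin.ext hi'
      exact hj
    have hcB : cB ((Classical.choose ha' : Fin T) : ℕ) b = ((Classical.choose hb' : Fin k) : ℕ) := by
      simp only [cB, dif_pos hb']
    -- both numbers fit into the announced bit budgets
    have hltA : cA a < 2 ^ Nat.clog 2 T := by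
      rw [hcA]
      exact lt_of_lt_of_le (Fin.isLt _) (Nat.le_pow_clog one_lt_two T)
    have hltB : cB (cA a) b < 2 ^ Nat.clog 2 k := by
      rw [hcA, hcB]
      exact lt_of_lt_of_le (Fin.isLt _) (Nat.le_pow_clog one_lt_two k)
    -- the play continues in `P i₀ j₀` on the pair `(a, b)`, which is legal for `h i₀ j₀`
    have hP' : P' (cA a) (cB (cA a) b) = P (Classical.choose ha') (Classical.choose hb') := by
      rw [hcA, hcB]
      simp only [P', dif_pos (And.intro (Classical.choose ha').isLt (Classical.choose hb').isLt),
        Fin.eta]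
    rw [KWTree.run_aliceChoose _ cA _ a b hltA, KWTree.run_bobChoose _ (cB (cA a)) _ a b hltB, hP']
    exact hP _ _ a b (hi₀ _) hj₀
  · -- depth: `⌈log₂ T⌉` rounds of Alice, `⌈log₂ k⌉` of Bob, then at most `D`
    have hdepth : ∀ i j, (P' i j).depth ≤ D := by
      intro i j
      simp only [P']
      split_ifs
      · exact hD _ _
      · simp
    rw [Nat.add_assoc]
    exact KWTree.depth_aliceChoose_le _ cA _ _ fun i _ =>
      KWTree.depth_bobChoose_le _ (cB i) _ D fun j _ => hdepth i j

/-- **Stub `KWOrAnd`** (registered stub `stub_kwOrAnd` of line `Sketch-ideator1`, crux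
stmt-ValiantsHypothesis-17124): if every `h i j` (`i : Fin T`, `j : Fin k`) has a protocol tree of
depth `≤ D` solving its monotone Karchmer–Wigderson game, then `a ↦ [∃ i, ∀ j, h i j a = 1]` has
one of depth `≤ ⌈log₂ T⌉ + ⌈log₂ k⌉ + D` (Alice names `i`, Bob names `j`, continue with the
protocol of `h i j`). Proof: `exists_kwTree_or_and`.
[cite: KarchmerWigderson1990, §2 (protocols for f ∨ g and f ∧ g in the monotone game)] -/
theorem stub_kwOrAnd :
    ∀ (ι : Type) [Nonempty ι] (T k D : ℕ) (h : Fin T → Fin k → (ι → Bool) → Bool),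
      (∀ i j, ∃ P : KWTree ι, P.SolvesMono (h i j) ∧ P.depth ≤ D) →
      ∃ P : KWTree ι, P.SolvesMono (fun a : ι → Bool => decide (∃ i, ∀ j, h i j a = true)) ∧
        P.depth ≤ Nat.clog 2 T + Nat.clog 2 k + D := by
  intro ι _ T k D h hex
  choose P hP hD using hex
  exact exists_kwTree_or_and h P hP hD _ fun a => decide_eq_true_iff

end Summit.ValiantsHypothesis.ValiantsHypothesis.Theorems.ShallowShadowsShadowFormulaTransfer
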